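import Summits.Ventures.PercRepro.C025ProfileSecondRowDirectSumLemmas

/-!
# THE SECOND ROW (q, ρ(E)−1) OF THE PROFILE INEQUALITY (Π) IS CLOSED UNDER DIRECT SUMS (night-3 g23)

`proofs/NIGHT3-G23-SECONDROW.md` §1.  For a finite matroid `M` of rank `ρ` the row `(q, ρ−1)` of (Π) reads
`(ρ/(q+1))·a₀ + a₁ ≤ h` with `a₀ = #{B : ρ(B) = q, E ∖ B spanning}`, `a₁ = #{B : ρ(B) = q, ρ(E ∖ B) = ρ−1}` and
`h = #{S : ρ(S) = ρ−1}`.  For `P = M ⊕ N` (Mathlib's `Matroid.disjointSum`) the level-`(ρ−1)` sets contain the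
unions of a level-`(ρ₁−1)` set of `M` with a spanning set of `N` and of a spanning set of `M` with a level-`(ρ₂−1)`
set of `N`, a member splits as `B₁ ⊔ B₂` with `ρ₁(B₁) + ρ₂(B₂) = q`, and the TOP ROW SUMMED OVER ALL RANKS is the
complementation identity `#{B ⊆ Eᵢ : Eᵢ ∖ B spanning} = #{S ⊆ Eᵢ : S spanning}`, which pays for the sum over the
splits `(q₁, q₂)`; the weights satisfy `ρ₁/(q₁+1) + ρ₂/(q₂+1) ≥ (ρ₁+ρ₂)/(q+1)` and, when `q₁ = ρ₁`,
`ρ₂/(q₂+1) ≥ (ρ₁+ρ₂)/(q+1)`.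
* `price_disjointSum_le` — the pointwise bound `price_P(B) ≤ G₁(B₁)·c₂(B₂) + c₁(B₁)·G₂(B₂)`;
* **`profileIneq_disjointSum_second (M N) [M.Finite] [N.Finite] (h : Disjoint M.E N.E) [(M.disjointSum N h).Finite]
  (h₁ : M.eRank = ρ₁) (h₂ : N.eRank = ρ₂) (hρ₁ : 1 ≤ ρ₁) (hρ₂ : 1 ≤ ρ₂) (hM : ∀ j, j + 2 ≤ ρ₁ → ProfileIneq M j (ρ₁ − 1))
  (hN : ∀ j, j + 2 ≤ ρ₂ → ProfileIneq N j (ρ₂ − 1)) (q) (hq : q + 2 ≤ ρ₁ + ρ₂) : ProfileIneq (M.disjointSum N h) q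
  (ρ₁ + ρ₂ − 1)`** — the row `(q, ρ₁+ρ₂−1)` of `M ⊕ N` from the rows `(j, ρᵢ−1)`, `j ≤ ρᵢ−2`, of the summands.
Consequences (paper): with the tree's reduction to simple matroids the second row on every finite matroid reduces
to simple connected matroids; it holds — hence `C025` at the corank-2 diagonal `(ρ, ρ−2)` — on every direct sum of
paving matroids.  No `def`, no `instance`, no notation.  Axioms: standard.
-/

open scoped Matroid

namespace PercRepro

open Set Finset ThmH

namespace SecondRow

variable {α : Type} [DecidableEq α]

section pointwise

variable (M N : Matroid α) [M.Finite] [N.Finite]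

omit [DecidableEq α] [M.Finite] in
/-- A rank `≤ ρ(E) = ρ` is a natural number `≤ ρ`. -/
theorem exists_nat_eRk_eq {ρ : ℕ} (hρ : M.eRank = (ρ : ℕ∞)) (X : Set α) :
    ∃ n : ℕ, M.eRk X = (n : ℕ∞) ∧ n ≤ ρ := by
  have hle : M.eRk X ≤ (ρ : ℕ∞) := hρ ▸ M.eRk_le_eRank X
  refine ⟨(M.eRk X).toNat, (ENat.coe_toNat (ne_top_of_le_ne_top (ENat.coe_ne_top ρ) hle)).symm, ?_⟩
  have := ENat.toNat_le_toNat hle (ENat.coe_ne_top ρ)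
  simpa using this

/-- `a/(q+1) ≤ a/(j+1)` for `j ≤ q`. -/
theorem div_succ_le_div_succ {a : ℚ} (ha : 0 ≤ a) {j q : ℕ} (hjq : j ≤ q) :
    a / ((q + 1 : ℕ) : ℚ) ≤ a / ((j + 1 : ℕ) : ℚ) := by
  apply div_le_div_of_nonneg_left ha (by positivity)
  exact_mod_cast Nat.succ_le_succ hjq

/-- The weight inequality when one part has full rank: `(ρ₁+ρ₂)/(q+1) ≤ ρ₁/(j₁+1)` for `j₁ + ρ₂ = q`, `j₁ < ρ₁`. -/
theorem div_le_div_of_full {ρ₁ ρ₂ j₁ q : ℕ} (hq : j₁ + ρ₂ = q) (hj : j₁ < ρ₁) :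
    ((ρ₁ + ρ₂ : ℕ) : ℚ) / ((q + 1 : ℕ) : ℚ) ≤ ((ρ₁ : ℕ) : ℚ) / ((j₁ + 1 : ℕ) : ℚ) := by
  rw [div_le_div_iff₀ (by positivity) (by positivity)]
  have hn : (ρ₁ + ρ₂) * (j₁ + 1) ≤ ρ₁ * (q + 1) := by
    subst hq
    nlinarith
  exact_mod_cast hn

/-- **The pointwise bound**: for a rank-`q` set `B` of `M ⊕ N` whose parts `B ∩ E_M`, `B ∩ E_N` have ranks `j₁`,
`j₂`, the price of `B` at the level `ρ₁+ρ₂−1` is at most `G₁·c₂ + c₁·G₂`, where `cᵢ` is the indicator of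
«the complement of the part spans `Mᵢ`» and `Gᵢ` is the price of the part in the row `(jᵢ, ρᵢ−1)` of `Mᵢ` when
`jᵢ < ρᵢ`, the indicator of «the complement of the part has rank `ρᵢ−1`» when `jᵢ = ρᵢ`. -/
theorem price_disjointSum_le (h : Disjoint M.E N.E) [(M.disjointSum N h).Finite]
    {ρ₁ ρ₂ : ℕ} (h₁ : M.eRank = (ρ₁ : ℕ∞)) (h₂ : N.eRank = (ρ₂ : ℕ∞)) (hρ₁ : 1 ≤ ρ₁) (hρ₂ : 1 ≤ ρ₂)
    {q : ℕ} (hq : q + 2 ≤ ρ₁ + ρ₂) {B : Finset α} (hB : B ∈ Profile.Rq (M.disjointSum N h) q)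
    {j₁ j₂ : ℕ} (hj₁ : M.eRk ((B ∩ gr M : Finset α) : Set α) = (j₁ : ℕ∞))
    (hj₂ : N.eRk ((B ∩ gr N : Finset α) : Set α) = (j₂ : ℕ∞)) :
    Profile.price (M.disjointSum N h) q (ρ₁ + ρ₂ - 1) B ≤
      (if j₁ < ρ₁ then Profile.price M j₁ (ρ₁ - 1) (B ∩ gr M)
        else (if M.eRk ((gr M \ (B ∩ gr M) : Finset α) : Set α) = ((ρ₁ - 1 : ℕ) : ℕ∞) then (1 : ℚ) else 0)) *
        (if N.eRk ((gr N \ (B ∩ gr N) : Finset α) : Set α) = (ρ₂ : ℕ∞) then (1 : ℚ) else 0) +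
      (if M.eRk ((gr M \ (B ∩ gr M) : Finset α) : Set α) = (ρ₁ : ℕ∞) then (1 : ℚ) else 0) *
        (if j₂ < ρ₂ then Profile.price N j₂ (ρ₂ - 1) (B ∩ gr N)
          else (if N.eRk ((gr N \ (B ∩ gr N) : Finset α) : Set α) = ((ρ₂ - 1 : ℕ) : ℕ∞) then (1 : ℚ) else 0)) := by
  have hgr : gr (M.disjointSum N h) = gr M ∪ gr N := gr_disjointSum M N h
  obtain ⟨hBs, hBr⟩ := Profile.mem_Rq.mp hB
  -- the rank of `B` splits
  have hsum : j₁ + j₂ = q := by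
    have := hBr
    rw [eRk_disjointSum_finset M N h, hj₁, hj₂, ← Nat.cast_add] at this
    exact_mod_cast this
  -- the complement ranks
  obtain ⟨n₁, hn₁, hn₁le⟩ := exists_nat_eRk_eq M h₁ ((gr M \ (B ∩ gr M) : Finset α) : Set α)
  obtain ⟨n₂, hn₂, hn₂le⟩ := exists_nat_eRk_eq N h₂ ((gr N \ (B ∩ gr N) : Finset α) : Set α)
  have hcomp : (M.disjointSum N h).eRk ((gr (M.disjointSum N h) \ B : Finset α) : Set α) =
      ((n₁ + n₂ : ℕ) : ℕ∞) := by
    rw [eRk_disjointSum_finset M N h, hgr, sdiff_inter_gr_left, sdiff_inter_gr_right, hn₁, hn₂,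
      Nat.cast_add]
  have hj₁le : j₁ ≤ ρ₁ := by
    have := M.eRk_le_eRank ((B ∩ gr M : Finset α) : Set α)
    rw [hj₁, h₁] at this; exact_mod_cast this
  have hj₂le : j₂ ≤ ρ₂ := by
    have := N.eRk_le_eRank ((B ∩ gr N : Finset α) : Set α)
    rw [hj₂, h₂] at this; exact_mod_cast this
  have hG₁ : 0 ≤ (if j₁ < ρ₁ then Profile.price M j₁ (ρ₁ - 1) (B ∩ gr M)
      else (if M.eRk ((gr M \ (B ∩ gr M) : Finset α) : Set α) = ((ρ₁ - 1 : ℕ) : ℕ∞) then (1 : ℚ) else 0)) := by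
    split_ifs <;> first | exact Profile.price_nonneg _ _ _ | norm_num
  have hG₂ : 0 ≤ (if j₂ < ρ₂ then Profile.price N j₂ (ρ₂ - 1) (B ∩ gr N)
      else (if N.eRk ((gr N \ (B ∩ gr N) : Finset α) : Set α) = ((ρ₂ - 1 : ℕ) : ℕ∞) then (1 : ℚ) else 0)) := by
    split_ifs <;> first | exact Profile.price_nonneg _ _ _ | norm_num
  have hc₁ : 0 ≤ (if M.eRk ((gr M \ (B ∩ gr M) : Finset α) : Set α) = (ρ₁ : ℕ∞) then (1 : ℚ) else 0) := by
    split_ifs <;> norm_num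
  have hc₂ : 0 ≤ (if N.eRk ((gr N \ (B ∩ gr N) : Finset α) : Set α) = (ρ₂ : ℕ∞) then (1 : ℚ) else 0) := by
    split_ifs <;> norm_num
  -- three cases on the rank of the complement
  rcases lt_trichotomy (n₁ + n₂) (ρ₁ + ρ₂ - 1) with hlt | heq | hgt
  · -- price 0
    rw [price_eq_zero_of_eRk_sdiff_lt (by rw [hcomp]; exact_mod_cast hlt)]
    exact add_nonneg (mul_nonneg hG₁ hc₂) (mul_nonneg hc₁ hG₂)
  · -- price 1: exactly one complement lost one unit of rank
    rw [price_eq_one_of_eRk_sdiff_eq (by rw [hcomp, heq])]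
    rcases Nat.lt_or_ge n₁ ρ₁ with hn₁lt | hn₁ge
    · have e₁ : n₁ = ρ₁ - 1 := by omega
      have e₂ : n₂ = ρ₂ := by omega
      have hc₂' : (if N.eRk ((gr N \ (B ∩ gr N) : Finset α) : Set α) = (ρ₂ : ℕ∞) then (1 : ℚ) else 0) = 1 := by
        rw [if_pos (by rw [hn₂, e₂])]
      have hc₁' : (if M.eRk ((gr M \ (B ∩ gr M) : Finset α) : Set α) = (ρ₁ : ℕ∞) then (1 : ℚ) else 0) = 0 := by
        rw [if_neg]
        rw [hn₁, e₁]
        intro hh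
        have : ρ₁ - 1 = ρ₁ := by exact_mod_cast hh
        omega
      have hG₁' : (if j₁ < ρ₁ then Profile.price M j₁ (ρ₁ - 1) (B ∩ gr M)
          else (if M.eRk ((gr M \ (B ∩ gr M) : Finset α) : Set α) = ((ρ₁ - 1 : ℕ) : ℕ∞) then (1 : ℚ) else 0)) = 1 := by
        split_ifs with hj hh
        · exact price_eq_one_of_eRk_sdiff_eq (by rw [hn₁, e₁])
        · rfl
        · exact absurd (by rw [hn₁, e₁]) hh
      rw [hc₂', hc₁', hG₁', one_mul, zero_mul, add_zero]
    · have e₁ : n₁ = ρ₁ := by omega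
      have e₂ : n₂ = ρ₂ - 1 := by omega
      have hc₁' : (if M.eRk ((gr M \ (B ∩ gr M) : Finset α) : Set α) = (ρ₁ : ℕ∞) then (1 : ℚ) else 0) = 1 := by
        rw [if_pos (by rw [hn₁, e₁])]
      have hc₂' : (if N.eRk ((gr N \ (B ∩ gr N) : Finset α) : Set α) = (ρ₂ : ℕ∞) then (1 : ℚ) else 0) = 0 := by
        rw [if_neg]
        rw [hn₂, e₂]
        intro hh
        have : ρ₂ - 1 = ρ₂ := by exact_mod_cast hh
        omega
      have hG₂' : (if j₂ < ρ₂ then Profile.price N j₂ (ρ₂ - 1) (B ∩ gr N)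
          else (if N.eRk ((gr N \ (B ∩ gr N) : Finset α) : Set α) = ((ρ₂ - 1 : ℕ) : ℕ∞) then (1 : ℚ) else 0)) = 1 := by
        split_ifs with hj hh
        · exact price_eq_one_of_eRk_sdiff_eq (by rw [hn₂, e₂])
        · rfl
        · exact absurd (by rw [hn₂, e₂]) hh
      rw [hc₁', hc₂', hG₂', mul_zero, zero_add, one_mul]
  · -- price (ρ₁+ρ₂)/(q+1): both complements spanning
    have e₁ : n₁ = ρ₁ := by omega
    have e₂ : n₂ = ρ₂ := by omega
    have hpr : Profile.price (M.disjointSum N h) q (ρ₁ + ρ₂ - 1) B =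
        ((ρ₁ + ρ₂ - 1 + 1 : ℕ) : ℚ) / ((q + 1 : ℕ) : ℚ) := by
      apply price_eq_div_of_eRk_sdiff_eq_succ
      rw [hcomp, e₁, e₂]
      congr 1
      omega
    have hc₁' : (if M.eRk ((gr M \ (B ∩ gr M) : Finset α) : Set α) = (ρ₁ : ℕ∞) then (1 : ℚ) else 0) = 1 := by
      rw [if_pos (by rw [hn₁, e₁])]
    have hc₂' : (if N.eRk ((gr N \ (B ∩ gr N) : Finset α) : Set α) = (ρ₂ : ℕ∞) then (1 : ℚ) else 0) = 1 := by
      rw [if_pos (by rw [hn₂, e₂])]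
    rw [hpr, hc₁', hc₂', mul_one, one_mul]
    have hρ : ρ₁ + ρ₂ - 1 + 1 = ρ₁ + ρ₂ := by omega
    rw [hρ]
    rcases Nat.lt_or_ge j₁ ρ₁ with hj₁lt | hj₁ge
    · have hG₁' : (if j₁ < ρ₁ then Profile.price M j₁ (ρ₁ - 1) (B ∩ gr M)
          else (if M.eRk ((gr M \ (B ∩ gr M) : Finset α) : Set α) = ((ρ₁ - 1 : ℕ) : ℕ∞) then (1 : ℚ) else 0)) =
          ((ρ₁ - 1 + 1 : ℕ) : ℚ) / ((j₁ + 1 : ℕ) : ℚ) := by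
        rw [if_pos hj₁lt]
        apply price_eq_div_of_eRk_sdiff_eq_succ
        rw [hn₁, e₁]
        congr 1
        omega
      rw [hG₁', show ρ₁ - 1 + 1 = ρ₁ by omega]
      rcases Nat.lt_or_ge j₂ ρ₂ with hj₂lt | hj₂ge
      · have hG₂' : (if j₂ < ρ₂ then Profile.price N j₂ (ρ₂ - 1) (B ∩ gr N)
            else (if N.eRk ((gr N \ (B ∩ gr N) : Finset α) : Set α) = ((ρ₂ - 1 : ℕ) : ℕ∞) then (1 : ℚ) else 0)) =
            ((ρ₂ - 1 + 1 : ℕ) : ℚ) / ((j₂ + 1 : ℕ) : ℚ) := by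
          rw [if_pos hj₂lt]
          apply price_eq_div_of_eRk_sdiff_eq_succ
          rw [hn₂, e₂]
          congr 1
          omega
        rw [hG₂', show ρ₂ - 1 + 1 = ρ₂ by omega, Nat.cast_add, add_div]
        exact add_le_add (div_succ_le_div_succ (by positivity) (by omega))
          (div_succ_le_div_succ (by positivity) (by omega))
      · -- `j₂ = ρ₂`: the `M`-weight alone suffices
        have hj₂eq : j₂ = ρ₂ := le_antisymm hj₂le hj₂ge
        calc ((ρ₁ + ρ₂ : ℕ) : ℚ) / ((q + 1 : ℕ) : ℚ)
            ≤ ((ρ₁ : ℕ) : ℚ) / ((j₁ + 1 : ℕ) : ℚ) := div_le_div_of_full (by omega) hj₁lt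
          _ ≤ ((ρ₁ : ℕ) : ℚ) / ((j₁ + 1 : ℕ) : ℚ) + _ := le_add_of_nonneg_right hG₂
    · -- `j₁ = ρ₁`, hence `j₂ < ρ₂`: the `N`-weight alone suffices
      have hj₁eq : j₁ = ρ₁ := le_antisymm hj₁le hj₁ge
      have hj₂lt : j₂ < ρ₂ := by omega
      have hG₂' : (if j₂ < ρ₂ then Profile.price N j₂ (ρ₂ - 1) (B ∩ gr N)
          else (if N.eRk ((gr N \ (B ∩ gr N) : Finset α) : Set α) = ((ρ₂ - 1 : ℕ) : ℕ∞) then (1 : ℚ) else 0)) =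
          ((ρ₂ - 1 + 1 : ℕ) : ℚ) / ((j₂ + 1 : ℕ) : ℚ) := by
        rw [if_pos hj₂lt]
        apply price_eq_div_of_eRk_sdiff_eq_succ
        rw [hn₂, e₂]
        congr 1
        omega
      rw [hG₂', show ρ₂ - 1 + 1 = ρ₂ by omega]
      calc ((ρ₁ + ρ₂ : ℕ) : ℚ) / ((q + 1 : ℕ) : ℚ)
          = ((ρ₂ + ρ₁ : ℕ) : ℚ) / ((q + 1 : ℕ) : ℚ) := by rw [Nat.add_comm]
        _ ≤ ((ρ₂ : ℕ) : ℚ) / ((j₂ + 1 : ℕ) : ℚ) := div_le_div_of_full (by omega) hj₂lt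
        _ ≤ _ + ((ρ₂ : ℕ) : ℚ) / ((j₂ + 1 : ℕ) : ℚ) := le_add_of_nonneg_left hG₁

end pointwise

section main

variable (M N : Matroid α) [M.Finite] [N.Finite]

/-- `B ↦ (B ∩ E_M, B ∩ E_N)` is injective on the subsets of `E_M ∪ E_N`. -/
theorem injOn_parts (h : Disjoint M.E N.E) [(M.disjointSum N h).Finite] {q : ℕ} :
    Set.InjOn (fun B : Finset α => (B ∩ gr M, B ∩ gr N)) (Profile.Rq (M.disjointSum N h) q : Set (Finset α)) := by
  have hgr : gr (M.disjointSum N h) = gr M ∪ gr N := gr_disjointSum M N h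
  intro B hB B' hB' hBB'
  simp only [Prod.mk.injEq] at hBB'
  have hBs : B ⊆ gr M ∪ gr N := hgr ▸ (Profile.mem_Rq.mp hB).1
  have hBs' : B' ⊆ gr M ∪ gr N := hgr ▸ (Profile.mem_Rq.mp hB').1
  have e : ∀ X : Finset α, X ⊆ gr M ∪ gr N → X = (X ∩ gr M) ∪ (X ∩ gr N) := by
    intro X hX
    rw [← Finset.inter_union_distrib_left, Finset.inter_eq_left.mpr hX]
  rw [e B hBs, e B' hBs', hBB'.1, hBB'.2]

/-- **THE SECOND ROW OF (Π) IS CLOSED UNDER DIRECT SUMS.**  If `M` (rank `ρ₁ ≥ 1`) and `N` (rank `ρ₂ ≥ 1`) on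
disjoint grounds satisfy the rows `(j, ρᵢ − 1)` of the profile inequality for every `j ≤ ρᵢ − 2`, then `M ⊕ N`
satisfies the row `(q, ρ₁ + ρ₂ − 1)` for every `q ≤ ρ₁ + ρ₂ − 2`. -/
theorem profileIneq_disjointSum_second (h : Disjoint M.E N.E) [(M.disjointSum N h).Finite]
    {ρ₁ ρ₂ : ℕ} (h₁ : M.eRank = (ρ₁ : ℕ∞)) (h₂ : N.eRank = (ρ₂ : ℕ∞)) (hρ₁ : 1 ≤ ρ₁) (hρ₂ : 1 ≤ ρ₂)
    (hM : ∀ j, j + 2 ≤ ρ₁ → Profile.ProfileIneq M j (ρ₁ - 1))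
    (hN : ∀ j, j + 2 ≤ ρ₂ → Profile.ProfileIneq N j (ρ₂ - 1))
    (q : ℕ) (hq : q + 2 ≤ ρ₁ + ρ₂) :
    Profile.ProfileIneq (M.disjointSum N h) q (ρ₁ + ρ₂ - 1) := by
  unfold Profile.ProfileIneq
  -- the weight of a pair of parts
  let G₁ : ℕ → Finset α → ℚ := fun j B₁ => if j < ρ₁ then Profile.price M j (ρ₁ - 1) B₁
    else (if M.eRk ((gr M \ B₁ : Finset α) : Set α) = ((ρ₁ - 1 : ℕ) : ℕ∞) then (1 : ℚ) else 0)
  let G₂ : ℕ → Finset α → ℚ := fun j B₂ => if j < ρ₂ then Profile.price N j (ρ₂ - 1) B₂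
    else (if N.eRk ((gr N \ B₂ : Finset α) : Set α) = ((ρ₂ - 1 : ℕ) : ℕ∞) then (1 : ℚ) else 0)
  let c₁ : Finset α → ℚ := fun B₁ => if M.eRk ((gr M \ B₁ : Finset α) : Set α) = (ρ₁ : ℕ∞) then 1 else 0
  let c₂ : Finset α → ℚ := fun B₂ => if N.eRk ((gr N \ B₂ : Finset α) : Set α) = (ρ₂ : ℕ∞) then 1 else 0
  let F : Finset α × Finset α → ℚ := fun p =>
    G₁ (M.eRk (p.1 : Set α)).toNat p.1 * c₂ p.2 + c₁ p.1 * G₂ (N.eRk (p.2 : Set α)).toNat p.2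
  have hG₁ : ∀ j B₁, 0 ≤ G₁ j B₁ := by
    intro j B₁; simp only [G₁]; split_ifs <;> first | exact Profile.price_nonneg _ _ _ | norm_num
  have hG₂ : ∀ j B₂, 0 ≤ G₂ j B₂ := by
    intro j B₂; simp only [G₂]; split_ifs <;> first | exact Profile.price_nonneg _ _ _ | norm_num
  have hc₁ : ∀ B₁, 0 ≤ c₁ B₁ := by intro B₁; simp only [c₁]; split_ifs <;> norm_num
  have hc₂ : ∀ B₂, 0 ≤ c₂ B₂ := by intro B₂; simp only [c₂]; split_ifs <;> norm_num
  have hF : ∀ p, 0 ≤ F p := fun p => add_nonneg (mul_nonneg (hG₁ _ _) (hc₂ _)) (mul_nonneg (hc₁ _) (hG₂ _ _))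
  -- step 1: the pointwise bound
  have step1 : ∑ B ∈ Profile.Rq (M.disjointSum N h) q, Profile.price (M.disjointSum N h) q (ρ₁ + ρ₂ - 1) B ≤
      ∑ B ∈ Profile.Rq (M.disjointSum N h) q, F (B ∩ gr M, B ∩ gr N) := by
    apply Finset.sum_le_sum
    intro B hB
    obtain ⟨j₁, hj₁, _⟩ := exists_nat_eRk_eq M h₁ ((B ∩ gr M : Finset α) : Set α)
    obtain ⟨j₂, hj₂, _⟩ := exists_nat_eRk_eq N h₂ ((B ∩ gr N : Finset α) : Set α)
    have := price_disjointSum_le M N h h₁ h₂ hρ₁ hρ₂ hq hB hj₁ hj₂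
    simp only [F, G₁, G₂, c₁, c₂, hj₁, hj₂, ENat.toNat_coe]
    exact this
  -- step 2: reindex by the parts, inside the union over the splits
  have step2 : ∑ B ∈ Profile.Rq (M.disjointSum N h) q, F (B ∩ gr M, B ∩ gr N) ≤
      ∑ p ∈ (Finset.range (q + 1)).biUnion (fun j => Profile.Rq M j ×ˢ Profile.Rq N (q - j)), F p := by
    rw [← Finset.sum_image (f := F) (g := fun B : Finset α => (B ∩ gr M, B ∩ gr N))
      (fun B hB B' hB' e => injOn_parts M N h (Finset.mem_coe.mpr hB) (Finset.mem_coe.mpr hB') e)]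
    apply Finset.sum_le_sum_of_subset_of_nonneg
    · intro p hp
      obtain ⟨B, hB, rfl⟩ := Finset.mem_image.mp hp
      obtain ⟨hBs, hBr⟩ := Profile.mem_Rq.mp hB
      have hgr : gr (M.disjointSum N h) = gr M ∪ gr N := gr_disjointSum M N h
      obtain ⟨j₁, hj₁, _⟩ := exists_nat_eRk_eq M h₁ ((B ∩ gr M : Finset α) : Set α)
      obtain ⟨j₂, hj₂, _⟩ := exists_nat_eRk_eq N h₂ ((B ∩ gr N : Finset α) : Set α)
      have hsum : j₁ + j₂ = q := by
        have := hBr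
        rw [eRk_disjointSum_finset M N h, hj₁, hj₂, ← Nat.cast_add] at this
        exact_mod_cast this
      rw [Finset.mem_biUnion]
      refine ⟨j₁, Finset.mem_range.mpr (by omega), ?_⟩
      rw [Finset.mem_product]
      refine ⟨Profile.mem_Rq.mpr ⟨Finset.inter_subset_right, hj₁⟩,
        Profile.mem_Rq.mpr ⟨Finset.inter_subset_right, ?_⟩⟩
      rw [hj₂]; congr 1; omega
    · intro p _ _; exact hF p
  -- step 3: the union over the splits is disjoint, and each split is a product
  have hdisj : ((Finset.range (q + 1) : Finset ℕ) : Set ℕ).PairwiseDisjoint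
      (fun j => Profile.Rq M j ×ˢ Profile.Rq N (q - j)) := by
    intro i _ k _ hik
    rw [Function.onFun, Finset.disjoint_left]
    rintro ⟨B₁, B₂⟩ hi hk
    rw [Finset.mem_product] at hi hk
    have hik' : (i : ℕ∞) = (k : ℕ∞) := (Profile.mem_Rq.mp hi.1).2.symm.trans (Profile.mem_Rq.mp hk.1).2
    exact hik (by exact_mod_cast hik')
  have step3 : ∑ p ∈ (Finset.range (q + 1)).biUnion (fun j => Profile.Rq M j ×ˢ Profile.Rq N (q - j)), F p =
      ∑ j ∈ Finset.range (q + 1),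
        ((∑ B₁ ∈ Profile.Rq M j, G₁ j B₁) * (∑ B₂ ∈ Profile.Rq N (q - j), c₂ B₂) +
          (∑ B₁ ∈ Profile.Rq M j, c₁ B₁) * (∑ B₂ ∈ Profile.Rq N (q - j), G₂ (q - j) B₂)) := by
    rw [Finset.sum_biUnion hdisj]
    apply Finset.sum_congr rfl
    intro j _
    rw [Finset.sum_product, Finset.sum_mul_sum, Finset.sum_mul_sum, ← Finset.sum_add_distrib]
    apply Finset.sum_congr rfl
    intro B₁ hB₁
    rw [← Finset.sum_add_distrib]
    apply Finset.sum_congr rfl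
    intro B₂ hB₂
    have e₁ : (M.eRk (B₁ : Set α)).toNat = j := by rw [(Profile.mem_Rq.mp hB₁).2, ENat.toNat_coe]
    have e₂ : (N.eRk (B₂ : Set α)).toNat = q - j := by rw [(Profile.mem_Rq.mp hB₂).2, ENat.toNat_coe]
    simp only [F, e₁, e₂]
  -- step 4: the member sums of each summand
  have hGM : ∀ j, ∑ B₁ ∈ Profile.Rq M j, G₁ j B₁ ≤ ((Shadow.levelSet M (ρ₁ - 1)).card : ℚ) :=
    fun j => sum_G_le hρ₁ hM j
  have hGN : ∀ j, ∑ B₂ ∈ Profile.Rq N j, G₂ j B₂ ≤ ((Shadow.levelSet N (ρ₂ - 1)).card : ℚ) :=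
    fun j => sum_G_le hρ₂ hN j
  have step4 : ∑ j ∈ Finset.range (q + 1),
        ((∑ B₁ ∈ Profile.Rq M j, G₁ j B₁) * (∑ B₂ ∈ Profile.Rq N (q - j), c₂ B₂) +
          (∑ B₁ ∈ Profile.Rq M j, c₁ B₁) * (∑ B₂ ∈ Profile.Rq N (q - j), G₂ (q - j) B₂)) ≤
      ((Shadow.levelSet M (ρ₁ - 1)).card : ℚ) * ((Shadow.levelSet N ρ₂).card : ℚ) +
        ((Shadow.levelSet M ρ₁).card : ℚ) * ((Shadow.levelSet N (ρ₂ - 1)).card : ℚ) := by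
    calc ∑ j ∈ Finset.range (q + 1),
          ((∑ B₁ ∈ Profile.Rq M j, G₁ j B₁) * (∑ B₂ ∈ Profile.Rq N (q - j), c₂ B₂) +
            (∑ B₁ ∈ Profile.Rq M j, c₁ B₁) * (∑ B₂ ∈ Profile.Rq N (q - j), G₂ (q - j) B₂))
        ≤ ∑ j ∈ Finset.range (q + 1),
          (((Shadow.levelSet M (ρ₁ - 1)).card : ℚ) * (∑ B₂ ∈ Profile.Rq N (q - j), c₂ B₂) +
            (∑ B₁ ∈ Profile.Rq M j, c₁ B₁) * ((Shadow.levelSet N (ρ₂ - 1)).card : ℚ)) := by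
          apply Finset.sum_le_sum
          intro j _
          apply add_le_add
          · exact mul_le_mul_of_nonneg_right (hGM j) (Finset.sum_nonneg (fun B₂ _ => hc₂ B₂))
          · exact mul_le_mul_of_nonneg_left (hGN (q - j)) (Finset.sum_nonneg (fun B₁ _ => hc₁ B₁))
      _ = ((Shadow.levelSet M (ρ₁ - 1)).card : ℚ) *
            (∑ j ∈ Finset.range (q + 1), ∑ B₂ ∈ Profile.Rq N (q - j), c₂ B₂) +
          (∑ j ∈ Finset.range (q + 1), ∑ B₁ ∈ Profile.Rq M j, c₁ B₁) *
            ((Shadow.levelSet N (ρ₂ - 1)).card : ℚ) := by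
          rw [Finset.sum_add_distrib, Finset.mul_sum, Finset.sum_mul]
      _ ≤ ((Shadow.levelSet M (ρ₁ - 1)).card : ℚ) * ((Shadow.levelSet N ρ₂).card : ℚ) +
            ((Shadow.levelSet M ρ₁).card : ℚ) * ((Shadow.levelSet N (ρ₂ - 1)).card : ℚ) := by
          apply add_le_add
          · apply mul_le_mul_of_nonneg_left _ (by positivity)
            have hrefl : ∑ j ∈ Finset.range (q + 1), ∑ B₂ ∈ Profile.Rq N (q - j), c₂ B₂ =
                ∑ j ∈ Finset.range (q + 1), ∑ B₂ ∈ Profile.Rq N j, c₂ B₂ := by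
              rw [← Finset.sum_range_reflect (fun j => ∑ B₂ ∈ Profile.Rq N j, c₂ B₂) (q + 1)]
              simp only [Nat.add_sub_cancel]
            rw [hrefl]
            exact sum_sum_c_le ρ₂ (Finset.range (q + 1))
          · apply mul_le_mul_of_nonneg_right _ (by positivity)
            exact sum_sum_c_le ρ₁ (Finset.range (q + 1))
  -- step 5: the second level of the sum
  have step5 : ((Shadow.levelSet M (ρ₁ - 1)).card : ℚ) * ((Shadow.levelSet N ρ₂).card : ℚ) +
        ((Shadow.levelSet M ρ₁).card : ℚ) * ((Shadow.levelSet N (ρ₂ - 1)).card : ℚ) ≤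
      ((Shadow.levelSet (M.disjointSum N h) (ρ₁ + ρ₂ - 1)).card : ℚ) := by
    have := card_levelSet_disjointSum_ge M N h hρ₁ hρ₂
    exact_mod_cast this
  exact step1.trans (step2.trans (step3.le.trans (step4.trans step5)))

end main

end SecondRow

end PercRepro
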